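import Summits.QuantumFields.YangMills.Theorems.UV3PinnedStepOfAnchored
import Summits.QuantumFields.YangMills.Theorems.UV3PinnedStepProfileReduction
import Literature.MathematicalPhysics.QuantumFieldTheory.Balaban1983to89.T3Thresholds
import HarnessLib

/-!
# S-FACE (v3 letter R-a′) — `stub_pinnedStep` v3 (Bałaban-shaped rate at a FREE profile per `(F, γ)`) AS A FACE OVER THE v3 (α) SOCKET AND ONE DISPLAYED ROW: the `E_K`-anchored
# PURE-PIN (41) AT THE PACKAGE PROFILE `(𝔠.b₀, 𝔠.p₀)`; floors and rate profile := the package profile; the (47)-half, the profile reduction and the envelope exchange by name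

Cell `ym3-torus` (YM ladder rung R3 = continuum `SU(2)` Yang–Mills on the three-torus — a RUNG, NOT d = 4, NOT infinite volume, NOT a mass gap, NOT Clay).
Twin-width seat `ym-ust-19936-w8` (gen 11); `--supports stmt-QuantumFields-19936 --as helper`, count-neutral, definition-free, default heartbeats.
Crux `UnitScaleTilt.HistoryTailL` (stmt-QuantumFields-19936); row R-19936-S.  ★★OWNER WORD 54∕55 + ideator `ym-r3-idea-2` g17 (write slot, 2026-08-29T22:19:59Z): (F2) profile
coupling ⇒ v3 letter R-a′ = the registered v2′ text with the constants line `∃ (b p Cu c : ℝ) (A : ℕ), 0 < b ∧ 1 ≤ p ∧ 0 < c ∧ …` and the rate `exp(−(c·pFun b p (g_{K−j}))²)` at a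
FREE profile chosen per `(F, γ)` (event, conditioner, guards, `M`-envelope unchanged); v3 registration by the write-slot holder.  The S-low twin of this file is
✓`UV3UnitEnvelopeFaceOfPackageV3.stub_unitEnvelope_of_packageV3_of_lfTop` (`ym3-torus-px12` g12, R-19936-U face of record): same socket hypothesis `hpkg`, same `π`, ONE organ row.

THE ROW DISPLAYED (`hPinA`, per block size `L` and v3 record `𝔠, a₀, a₁` with its family of sockets `hOf`; NO profile quantifier — the package profile is THE profile): per depth
`m` a threshold `γ₁ > 0` BEFORE the family, and per family of block size `L` and coupling in the window below `γ₁` SOME `Cu, c > 0, A` with, at the constrained heights and every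
height-`j` plaquette `a`, the PURE-PIN bound `ρ^{Pin(K,j,a)}_K ≤ exp(−Ecst K K + Cu)·β_{K−j}^A·exp(−c·p_{𝔠.b₀,𝔠.p₀}(g_{K−j})²)` `dV_K`-a.e., `Pin(K,j,a) := {θBal_{𝔠.b₀,𝔠.p₀}(K−j) ≤
dist1(Ū^j(∂a))}`, `Ecst` = the socket datum's own constant (64).  This is [Balaban1985UV3] (41) p.266 with (7) p.257 pinned to «`a ∈ P_j`», the large-field factor (70)–(71) p.273 kept
for the pin and resummed over the other histories — the UV-stability induction re-run with one pinned characteristic function, at the package's own threshold (`eps1Of j = θBal(K−j)`,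
✓`PkgAtV3.eps1_eq`); NOT printed as such; NOT proved here (R-19936-S's organ; cf. `ym3-torus-px8` g11 BRICKS `UV3PinnedTransportStep`∕`UV3PinnedRestrictedStep` for its (41)-half).
(The binders `hc'`, `hγ1'` and the profile `(hF ▸ 𝔠).b₀, (hF ▸ 𝔠).p₀` inside the row are read at the transported record; at a family of block size `L` they are the plain ones.)

THE FACE: ★★★ `stub_pinnedStepV3_of_packageV3_of_purePinTop (hpkg) (π) (hPinA) : ⟨stub_pinnedStep v3⟩` — floors AND rate profile `:= (𝔠.b₀, 𝔠.p₀)` (`𝔠.b₀_pos`, `𝔠.two_lt_p₀`);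
`γ₁ := min` of the window `(min γ₀ 1)²`, the two `θBal(0)`-smallness thresholds of the v3 (47)-half (lit ✓`T3Thresholds.exists_gamma_forall_mul_θBal_le`), the row's `γ₁` and `1`; per
`(F, γ)`: ✓`UV3PinnedStepProfileReduction.anchoredStep_of_purePin_floor` (every `(b₀, p₀) ⪰` floors, floor rate) → ✓`UV3UnitPartitionLowerOfPackageV3.exp_Ecst_le_partitionFn_of_packageV3`
((47)-half) → ✓`UV3PinnedStepOfAnchored.ae_resDensity_le_envelope_of_anchored` (`Cu ↦ Cu + Cl`); `L ≤ 1` vacuous.  It closes nothing.  The conclusion is the v3 CANDIDATE letter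
(to be matched byte for byte against the registered v3).

HONEST SCOPE.  Bookkeeping; CONDITIONAL on the v3 socket (the UV3 node's (α) inputs, hypothesis schema) and on the displayed organ row; nothing of `stub_pinnedStep` (v2′ or v3),
`stub_unitEnvelope`, `hP`, `HistoryTailL` (19936) or the rung is proved here.  Sorry-free, axioms standard.

References: T. Bałaban, *Ultraviolet stability of three-dimensional lattice pure gauge field theories*, Commun. Math. Phys. **102** (1985) 255–275
[Balaban1985UV3] ((2) p.256, (5)–(7) pp.256–257, (41) p.266, (47) p.267, (64) p.273, (70)–(71) p.273).
-/

set_option autoImplicit false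

noncomputable section

namespace Summit.QuantumFields.YangMills.Theorems.UV3PinnedStepV3FaceOfPackageV3

open MeasureTheory
open Literature.MathematicalPhysics.QuantumFieldTheory.Balaban1983to89
open Literature.MathematicalPhysics.QuantumFieldTheory.Balaban1983to89.T3ContinuumYM3Torus
open Literature.MathematicalPhysics.QuantumFieldTheory.Balaban1983to89.T3UnitLawDensityEML (ℰp emlDensity)
open Literature.MathematicalPhysics.QuantumFieldTheory.Balaban1983to89.T3UnitScaleTilt (θBal)
open Literature.MathematicalPhysics.QuantumFieldTheory.Balaban1983to89.T3RestrictedUnitDensity (resDensity)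
open Literature.MathematicalPhysics.QuantumFieldTheory.Balaban1983to89.T3AlphaInputsAC
open Literature.MathematicalPhysics.QuantumFieldTheory.Balaban1985CMP102
open Literature.MathematicalPhysics.QuantumFieldTheory.Balaban1985CMP102.Setting
open Summit.QuantumFields.Balaban3D.Carriers
open Summit.QuantumFields.Balaban3D.Proofs.Primitives
open Summit.QuantumFields.YangMills.Theorems.UV3UnitPartitionLowerOfPackageV3 (exp_Ecst_le_partitionFn_of_packageV3)
open Summit.QuantumFields.YangMills.Theorems.UV3PinnedStepOfAnchored (ae_resDensity_le_envelope_of_anchored)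
open Summit.QuantumFields.YangMills.Theorems.UV3PinnedStepProfileReduction (anchoredStep_of_purePin_floor)

/-- ★★★ **`stub_pinnedStep` v3 (R-a′: free rate profile per `(F, γ)`) AS A FACE OVER THE v3 SOCKET AND THE PURE-PIN ANCHORED (41) AT THE PACKAGE PROFILE.**  Hypotheses: `hpkg` — the v3 T3
(α) socket for every block size `L > 1` (as in ✓`UV3UnitEnvelopeFaceOfPackageV3`); `π` — polymer fields; `hPinA` — per `L` and record, per depth a threshold, per family∕coupling
the `Ecst`-anchored pure-pin (41) at the package profile (R-19936-S's organ, displayed).  Conclusion: S-step v3 with floors `(b₁', p₁')` and rate profile `(b, p)` both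
`:= (𝔠.b₀, 𝔠.p₀)`, for every profile `(b₀, p₀)` above the floors and every a.e. envelope `M` of `ρ_K`. [cite: Balaban1985UV3, (5) p.256, (7) p.257, (41) p.266, (47) p.267, (64) p.273, (70)–(71) p.273] -/
theorem stub_pinnedStepV3_of_packageV3_of_purePinTop
    (hpkg : ∀ L : ℕ, 1 < L → ∃ (𝔠 : AlphaConsts L (suGroupModel 2).N) (a₀ a₁ : ℝ),
      (0 < a₀ ∧ 0 < a₁ ∧ 𝔠.B₃ * a₁ ≤ a₀) ∧ ∀ (F : T3Family) (hF : F.L = L), AlphaInputsT3AC.OfV3At F (hF ▸ 𝔠) a₀ a₁)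
    (π : ∀ F : T3Family, AlphaInputsT3AC.PolymerT3 F)
    (hPinA : ∀ (L : ℕ) (𝔠 : AlphaConsts L (suGroupModel 2).N) (a₀ a₁ : ℝ),
      (0 < a₀ ∧ 0 < a₁ ∧ 𝔠.B₃ * a₁ ≤ a₀) →
      ∀ (hOf : ∀ (F : T3Family) (hF : F.L = L), AlphaInputsT3AC.OfV3At F (hF ▸ 𝔠) a₀ a₁),
        ∀ (m : ℕ), 0 < m →
          ∃ γ₁ : ℝ, 0 < γ₁ ∧ ∀ (F : T3Family) (hF : F.L = L)
            (hc' : 0 < a₀ ∧ 0 < a₁ ∧ (hF ▸ 𝔠).B₃ * a₁ ≤ a₀) (γ : ℝ) (hγ : 0 < γ) (hγ1' : γ ≤ (min (hF ▸ 𝔠).gamma0 1) ^ 2), γ ≤ γ₁ →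
            ∃ (Cu c : ℝ) (A : ℕ), 0 < c ∧
              ∀ (K j : ℕ), 1 ≤ j → j + 2 ≤ K → j + (K - 1) / m ≤ K → ∀ (a : Plaq (F.P K) j),
                ∀ᵐ V ∂(fieldMeasure (F.P K) K (Matrix.specialUnitaryGroup (Fin 2) ℂ)),
                  resDensity F γ K
                    {U : GaugeField (F.P K) 0 (Matrix.specialUnitaryGroup (Fin 2) ℂ) |
                      θBal F.L γ (hF ▸ 𝔠).b₀ (hF ▸ 𝔠).p₀ (K - j) ≤ GaugeGroup.dist1 (GaugeField.plaqHol
                        (Averaging.iter (fun i' => BlockAveraging.blockAvg (P := F.P K) (j := i') ℰp) j U) a)}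
                    K V ≤
                  Real.exp (-(((hOf F hF).dataT3v3 hc' γ hγ hγ1' (π F)).Ecst K K) + Cu) *
                    ((F.scheme ℰp γ).β (K - j) ^ A *
                      Real.exp (-(c * B10.pFun (hF ▸ 𝔠).b₀ (hF ▸ 𝔠).p₀ (Real.sqrt (γ * ((F.L : ℝ)⁻¹) ^ (K - j))) ^ 2)))) :
    ∀ (L : ℕ), ∃ (b₁' p₁' : ℝ), ∀ (b₀ p₀ : ℝ), b₁' ≤ b₀ → p₁' ≤ p₀ → 0 < b₀ → 2 < p₀ → ∀ (m : ℕ), 0 < m →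
      ∃ γ₁ : ℝ, 0 < γ₁ ∧ γ₁ ≤ 1 ∧ ∀ (F : T3Family) (γ : ℝ), F.L = L → 0 < γ → γ ≤ γ₁ →
        ∃ (b p Cu c : ℝ) (A : ℕ), 0 < b ∧ 1 ≤ p ∧ 0 < c ∧ ∀ (K j : ℕ), 1 ≤ j → j + 2 ≤ K → j + (K - 1) / m ≤ K → ∀ (a : Plaq (F.P K) j) (M : ℝ),
          (∀ᵐ V ∂(fieldMeasure (F.P K) K (Matrix.specialUnitaryGroup (Fin 2) ℂ)), emlDensity F γ K K V ≤ M) →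
          ∀ᵐ V ∂(fieldMeasure (F.P K) K (Matrix.specialUnitaryGroup (Fin 2) ℂ)),
            resDensity F γ K
              ({U : GaugeField (F.P K) 0 (Matrix.specialUnitaryGroup (Fin 2) ℂ) |
                  θBal F.L γ b₀ p₀ (K - j) ≤ GaugeGroup.dist1 (GaugeField.plaqHol
                    (Averaging.iter (fun i' => BlockAveraging.blockAvg (P := F.P K) (j := i') ℰp) j U) a)} ∩
                {U : GaugeField (F.P K) 0 (Matrix.specialUnitaryGroup (Fin 2) ℂ) | ∀ i, i < j →
                  PlaqSmall (θBal F.L γ b₀ p₀ (K - i))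
                    (Averaging.iter (fun i' => BlockAveraging.blockAvg (P := F.P K) (j := i') ℰp) i U)})
              K V ≤
            M * Real.exp Cu *
              ((F.scheme ℰp γ).β (K - j) ^ A * Real.exp (-(c * B10.pFun b p (Real.sqrt (γ * ((F.L : ℝ)⁻¹) ^ (K - j))) ^ 2))) := by
  intro L
  by_cases hL : 1 < L
  · obtain ⟨𝔠, a₀, a₁, hc, hOf⟩ := hpkg L hL
    have HP := hPinA L 𝔠 a₀ a₁ hc hOf
    -- the two `θBal(0)`-smallness thresholds of the v3 (47)-half
    obtain ⟨γa, hγa, -, ha⟩ := T3Thresholds.exists_gamma_forall_mul_θBal_le (b₀ := 𝔠.b₀) (p₀ := 𝔠.p₀) 𝔠.b₀_pos 𝔠.p₀_pos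
      (B := 1) zero_le_one (ε₀ := a₁) hc.2.1
    obtain ⟨γb, hγb, -, hb⟩ := T3Thresholds.exists_gamma_forall_mul_θBal_le (b₀ := 𝔠.b₀) (p₀ := 𝔠.p₀) 𝔠.b₀_pos 𝔠.p₀_pos
      (B := 𝔠.B₃) 𝔠.B₃_pos.le (ε₀ := a₀) hc.1
    have hγ0 : 0 < (min 𝔠.gamma0 1) ^ 2 := pow_pos (lt_min 𝔠.gamma0_pos one_pos) 2
    refine ⟨𝔠.b₀, 𝔠.p₀, fun b₀ p₀ hbb hpp _ _ m hm => ?_⟩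
    obtain ⟨γ₁, hγ₁, HF⟩ := HP m hm
    refine ⟨min (min ((min 𝔠.gamma0 1) ^ 2) (min γa γb)) (min γ₁ 1),
      lt_min (lt_min hγ0 (lt_min hγa hγb)) (lt_min hγ₁ one_pos), (min_le_right _ _).trans (min_le_right _ _), ?_⟩
    intro F γ hF hγ hγle
    subst hF
    have h : AlphaInputsT3AC.OfV3At F 𝔠 a₀ a₁ := hOf F rfl
    have hγ1 : γ ≤ (min 𝔠.gamma0 1) ^ 2 := hγle.trans ((min_le_left _ _).trans (min_le_left _ _))
    have hγone : γ ≤ 1 := hγle.trans ((min_le_right _ _).trans (min_le_right _ _))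
    have hγγ₁ : γ ≤ γ₁ := hγle.trans ((min_le_right _ _).trans (min_le_left _ _))
    have hL1 : 1 ≤ F.L := le_of_lt F.hL.2
    have ha₁ : θBal F.L γ 𝔠.b₀ 𝔠.p₀ 0 ≤ a₁ := by
      have := ha F.L hL1 γ hγ (hγle.trans ((min_le_left _ _).trans ((min_le_right _ _).trans (min_le_left _ _)))) 0
      simpa using this
    have ha₀ : 𝔠.B₃ * θBal F.L γ 𝔠.b₀ 𝔠.p₀ 0 ≤ a₀ :=
      hb F.L hL1 γ hγ (hγle.trans ((min_le_left _ _).trans ((min_le_right _ _).trans (min_le_right _ _)))) 0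
    -- the pure-pin row at the package profile, then every steeper profile at the floor rate
    have hPin := HF F rfl hc γ hγ hγ1 hγγ₁
    obtain ⟨Cu, c, A, hcpos, hstep⟩ :=
      anchoredStep_of_purePin_floor F hγ.le hγone 𝔠.b₀_pos.le (fun K => (h.dataT3v3 hc γ hγ hγ1 (π F)).Ecst K K) m hPin hbb hpp
    -- the (47)-half of the v3 socket, then the envelope exchange
    obtain ⟨Cl, hlow⟩ := exp_Ecst_le_partitionFn_of_packageV3 h hc γ hγ hγ1 (π F) ha₁ ha₀
    refine ⟨𝔠.b₀, 𝔠.p₀, Cu + Cl, c, A, 𝔠.b₀_pos, by linarith [𝔠.two_lt_p₀], hcpos, fun K j hj1 hjK hjm a M hM => ?_⟩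
    have hw : 0 ≤ (F.scheme ℰp γ).β (K - j) ^ A *
        Real.exp (-(c * B10.pFun 𝔠.b₀ 𝔠.p₀ (Real.sqrt (γ * ((F.L : ℝ)⁻¹) ^ (K - j))) ^ 2)) :=
      mul_nonneg (pow_nonneg (F.scheme_β_nonneg ℰp hγ.le (K - j)) A) (Real.exp_nonneg _)
    exact ae_resDensity_le_envelope_of_anchored F hγ.le K _ hw (hstep K j hj1 hjK hjm a) (hlow K) M hM
  · -- no three-torus family has block size `L ≤ 1`: every clause about such families is vacuous
    refine ⟨1, 1, fun b₀ p₀ _ _ _ _ m _ => ⟨1, one_pos, le_rfl, fun F γ hF _ _ => ?_⟩⟩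
    exact absurd (hF ▸ F.hL.2) hL

end Summit.QuantumFields.YangMills.Theorems.UV3PinnedStepV3FaceOfPackageV3

end
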